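import Summits.Ventures.CertifiedManyBodySolver.Observables.PhaseSeparationExclusionU8GrandCanonical
import Literature.MathematicalPhysics.QuantumLattice.HubbardTTPrimeGrandCanonicalEquilibriumParticleHole
import Literature.MathematicalPhysics.QuantumLattice.HubbardTTPrimeGrandCanonicalEquilibriumStateDictionary
import HarnessLib

/-!
# Ventures/CertifiedManyBodySolver — Observables/PhaseSeparationExclusionU8GrandCanonicalElectronDopedThermal.lean: the ELECTRON-DOPED mirror of the
# registry `T > 0` chemical-potential-axis sentences at `(U, t′) = (8, 0)` — no `(β, μ)` carries variational equilibria of both the `≤ 1`-filled and the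
# `≥ 3/2`-filled phase for every `β ≥ 16`, and their chemical potentials differ by `≥ 2t/25` (`β ≥ 20`), `≥ t/5` (`β ≥ 32`)

HONEST FRAMING: first certified bounds; not a superconductivity verdict. CLASS = DERIVED / CONTEXT (one-liners): the particle–hole images of
`psU8muT_not_equilibrium_ge_one_of_equilibrium_le_half_beta16`, `psU8muT_chemPot_gap_2o25_beta20`, `psU8muT_chemPot_gap_1o5_beta32`
(`PhaseSeparationExclusionU8GrandCanonical` §2, g22) under the `T > 0` state-level reflection `IsVarEquilibrium.particleHole_of_muShift_reflect`
(`Literature/…/HubbardTTPrimeGrandCanonicalEquilibriumParticleHole`, g23: equilibria of `H(t,t',U) − μN` ↦ equilibria of `H(t,−t',U) − (U − μ)N`, density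
`ρ ↦ 2 − ρ`; at `t′ = 0` the model is its own mirror). EXACT SYMMETRY TRANSPORT — no new information about the model; conditional BY NAME on the same claim
nodes (#576 · #546 · #428, anchors j262363 / j300674); CONTROL class (the excluded partner has density `≥ 3/2`, electron doping `≥ 50 %`); statements about
translation-invariant variational equilibria of `H − μN` for ANY `Γ` with `e_Γ = e_{Φ(1,0,8)} − μρ`; a FLOOR on `Δμ`; nothing about superconductivity or
`T_c`; no number of record. Zero compute. `T = 0` electron-doped `μ` sentences are §5 of `PhaseSeparationExclusionU8GrandCanonical`.
Cell `pub/hubbard-downfold` (MO-S1 ↔ S2 seam «box ↦ one word», filling direction = Legendre pair `μ ↔ n`, reflection `μ ↦ U − μ`), seat `hubbard-downfold-unc-2` (g23).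
READING (CONTROL; electron-doped side of the `U/t = 8`, `t′ = 0` registry point, e.g. the NCCO-class annotation at `t′ = 0` only): «at every `T ≲ 250 K`
(`β ≥ 16`) no chemical potential carries both a `≤ 1`-filled and a `≥ 3/2`-filled equilibrium state; at `T ≲ 200 K` their chemical potentials differ by
`≥ 0.08 t`, at `T ≲ 130 K` by `≥ 0.2 t`».
References: [cite: LiebPRL1989, proof of Theorem 2]; [cite: Israel1979, Thm. I.2.4]; [cite: PoulinHastings2011, eqs. (3)–(8)]; [cite: EmeryKivelsonLin1990, pp. 475–476].
-/

noncomputable section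

namespace Summit.Ventures.CertifiedManyBodySolver.Observables

open Matrix Finset Filter Topology Set Literature.MathematicalPhysics.QuantumLattice
open Literature.Probability.LatticeModels HubbardWave0 ThermodynamicLimit InfVolFermionState
open Summit.Ventures.CertifiedManyBodySolver.Certificates
open scoped ComplexOrder

/-- The `μ`-pencil and the grand-canonical interaction at `(μ, h = 0)` have the same mean-energy functional, hence the same variational equilibria
(`β > 0`). [cite: Israel1979, Thm. I.2.4] -/
private theorem isVarEquilibrium_gc_of_pencil {β ν : ℝ} (hβ : 0 < β) {σ : InfVolFermionState 2}
    (h : σ.IsVarEquilibrium β (hubbardTTPrimeMuInteraction 1 0 8 ν) 1) : σ.IsVarEquilibrium β (gcInteractionTT' 1 0 8 ν 0) 1 := by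
  refine ⟨h.1, ?_⟩
  rw [varPressure_eq_gcPressureTT'_of_muShift 1 0 (U := 8) (by norm_num) hβ (meanEnergy_gcInteractionTT'_zero_field_eq_sub 1 0 8 ν),
    ← varPressure_eq_gcPressureTT'_of_muShift 1 0 (U := 8) (by norm_num) hβ (meanEnergy_hubbardTTPrimeMu_eq_sub 1 0 8 ν),
    meanEnergy_gcInteractionTT'_zero_field_eq_sub, ← meanEnergy_hubbardTTPrimeMu_eq_sub]
  exact h.2

/-- **NO `(β, μ)` CARRIES BOTH A `≤ 1`-FILLED AND A `≥ 3/2`-FILLED EQUILIBRIUM, every `β ≥ 16`** (`U = 8`, `t′ = 0`, zero field; electron-doped mirror of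
`psU8muT_not_equilibrium_ge_one_of_equilibrium_le_half_beta16`): for every `μ` and every `Γ` with `e_Γ = e_Φ − μρ`, if `Γ` has a translation-invariant
variational equilibrium at `β` of density `≤ 1`, it has none of density `≥ 3/2`. [cite: LiebPRL1989, proof of Theorem 2] [cite: Israel1979, Thm. I.2.4] [cite: PoulinHastings2011, eqs. (3)–(8)] -/
theorem psU8muT_not_equilibrium_ge_3o2_of_equilibrium_le_one_beta16_electronDoped
    (h576 : cert_r576_bs_GU8n1o2tp0_w3_b4_R2_ob5p2_kry1_kry2c3rel_hanK7B4D4_KN4_PR20d4_hanK8c2s_uprime)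
    (h546 : cert_stripcell2_VAR32x4n34D1400_nc4_x12) (h428 : cert_r428_hubSQ_hanK7R6_U8_r5_e4_so4blk)
    (hA1 : cert_feC1_stair221_b3o2_j300674) (hA2 : cert_feC1_3x2_b1o2_j262363)
    {β : ℝ} (hβ : (16 : ℝ) ≤ β) {Γ : FermionInteraction 2} {R₀ μ : ℝ} {ω₁ ω₂ : InfVolFermionState 2}
    (hΓ : ∀ σ : InfVolFermionState 2, σ.meanEnergy Γ R₀ = σ.meanEnergy (hubbardTTPrimeFermionInteraction 1 0 8) 1 - μ * σ.density)
    (hω₁ : ω₁.IsVarEquilibrium β Γ R₀) (hρ₁ : ω₁.density ≤ 1) (hρ₂ : 3 / 2 ≤ ω₂.density) :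
    ¬ ω₂.IsVarEquilibrium β Γ R₀ := by
  have hβ0 : (0 : ℝ) < β := lt_of_lt_of_le (by norm_num) hβ
  refine not_isVarEquilibrium_electronDoped_of_holeDoped 1 0 8 β (m₁ := 1) (m₂ := 3 / 2) ?_ hΓ hω₁ hρ₁ hρ₂
  intro σ₁ σ₂ k₁ hd₁ hd₂ k₂
  rw [neg_zero] at k₁ k₂
  exact psU8muT_not_equilibrium_ge_one_of_equilibrium_le_half_beta16 h576 h546 h428 hA1 hA2 hβ (isVarEquilibrium_gc_of_pencil hβ0 k₁)
    (by linarith) (by linarith) (isVarEquilibrium_gc_of_pencil hβ0 k₂)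

/-- **CERTIFIED GAP `Δμ ≥ 2t/25` ON THE ELECTRON-DOPED SIDE, every `β ≥ 20`** (`U = 8`, `t′ = 0`): if `μ₁` carries a translation-invariant variational
equilibrium of `H − μ₁N` at `β` of density `≤ 1` and `μ₂` one of `H − μ₂N` of density `≥ 3/2`, then `μ₂ − μ₁ ≥ 2/25` (mirror of `psU8muT_chemPot_gap_2o25_beta20`).
[cite: LiebPRL1989, proof of Theorem 2] [cite: Israel1979, Thm. I.2.4] [cite: PoulinHastings2011, eqs. (3)–(8)] -/
theorem psU8muT_chemPot_gap_2o25_beta20_electronDoped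
    (h576 : cert_r576_bs_GU8n1o2tp0_w3_b4_R2_ob5p2_kry1_kry2c3rel_hanK7B4D4_KN4_PR20d4_hanK8c2s_uprime)
    (h546 : cert_stripcell2_VAR32x4n34D1400_nc4_x12) (h428 : cert_r428_hubSQ_hanK7R6_U8_r5_e4_so4blk)
    (hA1 : cert_feC1_stair221_b3o2_j300674) (hA2 : cert_feC1_3x2_b1o2_j262363)
    {β : ℝ} (hβ : (20 : ℝ) ≤ β) {Γ₁ Γ₂ : FermionInteraction 2} {R₁ R₂ μ₁ μ₂ : ℝ} {ω₁ ω₂ : InfVolFermionState 2}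
    (hΓ₁ : ∀ σ : InfVolFermionState 2, σ.meanEnergy Γ₁ R₁ = σ.meanEnergy (hubbardTTPrimeFermionInteraction 1 0 8) 1 - μ₁ * σ.density)
    (hΓ₂ : ∀ σ : InfVolFermionState 2, σ.meanEnergy Γ₂ R₂ = σ.meanEnergy (hubbardTTPrimeFermionInteraction 1 0 8) 1 - μ₂ * σ.density)
    (hω₁ : ω₁.IsVarEquilibrium β Γ₁ R₁) (hρ₁ : ω₁.density ≤ 1) (hω₂ : ω₂.IsVarEquilibrium β Γ₂ R₂) (hρ₂ : 3 / 2 ≤ ω₂.density) :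
    (2 : ℝ) / 25 ≤ μ₂ - μ₁ := by
  have hβ0 : (0 : ℝ) < β := lt_of_lt_of_le (by norm_num) hβ
  refine sub_chemPot_electronDoped_of_holeDoped 1 0 8 β (m₁ := 1) (m₂ := 3 / 2) (g := (2 : ℝ) / 25) ?_ hΓ₁ hΓ₂ hω₁ hρ₁ hω₂ hρ₂
  intro ν₁ ν₂ σ₁ σ₂ k₁ hd₁ k₂ hd₂
  rw [neg_zero] at k₁ k₂
  exact psU8muT_chemPot_gap_2o25_beta20 h576 h546 h428 hA1 hA2 hβ (isVarEquilibrium_gc_of_pencil hβ0 k₁) (by linarith)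
    (isVarEquilibrium_gc_of_pencil hβ0 k₂) (by linarith)

/-- **CERTIFIED GAP `Δμ ≥ t/5` ON THE ELECTRON-DOPED SIDE, every `β ≥ 32`** (`U = 8`, `t′ = 0`; mirror of `psU8muT_chemPot_gap_1o5_beta32`).
[cite: LiebPRL1989, proof of Theorem 2] [cite: Israel1979, Thm. I.2.4] [cite: PoulinHastings2011, eqs. (3)–(8)] -/
theorem psU8muT_chemPot_gap_1o5_beta32_electronDoped
    (h576 : cert_r576_bs_GU8n1o2tp0_w3_b4_R2_ob5p2_kry1_kry2c3rel_hanK7B4D4_KN4_PR20d4_hanK8c2s_uprime)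
    (h546 : cert_stripcell2_VAR32x4n34D1400_nc4_x12) (h428 : cert_r428_hubSQ_hanK7R6_U8_r5_e4_so4blk)
    (hA1 : cert_feC1_stair221_b3o2_j300674) (hA2 : cert_feC1_3x2_b1o2_j262363)
    {β : ℝ} (hβ : (32 : ℝ) ≤ β) {Γ₁ Γ₂ : FermionInteraction 2} {R₁ R₂ μ₁ μ₂ : ℝ} {ω₁ ω₂ : InfVolFermionState 2}
    (hΓ₁ : ∀ σ : InfVolFermionState 2, σ.meanEnergy Γ₁ R₁ = σ.meanEnergy (hubbardTTPrimeFermionInteraction 1 0 8) 1 - μ₁ * σ.density)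
    (hΓ₂ : ∀ σ : InfVolFermionState 2, σ.meanEnergy Γ₂ R₂ = σ.meanEnergy (hubbardTTPrimeFermionInteraction 1 0 8) 1 - μ₂ * σ.density)
    (hω₁ : ω₁.IsVarEquilibrium β Γ₁ R₁) (hρ₁ : ω₁.density ≤ 1) (hω₂ : ω₂.IsVarEquilibrium β Γ₂ R₂) (hρ₂ : 3 / 2 ≤ ω₂.density) :
    (1 : ℝ) / 5 ≤ μ₂ - μ₁ := by
  have hβ0 : (0 : ℝ) < β := lt_of_lt_of_le (by norm_num) hβ
  refine sub_chemPot_electronDoped_of_holeDoped 1 0 8 β (m₁ := 1) (m₂ := 3 / 2) (g := (1 : ℝ) / 5) ?_ hΓ₁ hΓ₂ hω₁ hρ₁ hω₂ hρ₂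
  intro ν₁ ν₂ σ₁ σ₂ k₁ hd₁ k₂ hd₂
  rw [neg_zero] at k₁ k₂
  exact psU8muT_chemPot_gap_1o5_beta32 h576 h546 h428 hA1 hA2 hβ (isVarEquilibrium_gc_of_pencil hβ0 k₁) (by linarith)
    (isVarEquilibrium_gc_of_pencil hβ0 k₂) (by linarith)

end Summit.Ventures.CertifiedManyBodySolver.Observables

end
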